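import Mathlib
import HarnessLib.Audit
import Summits.PneNP.PneNP.Theorems.PstarNorUnitExcCore

/-!
# Consequences of the EXC-unit polar formula: no NOR chord, uniqueness, the (EQ) companion (ROUND-24, memo §9 R8/R9, residue (c))

FRONTIER range-avoidance ladder, rung F-N3, ROUND 24 (cell `pnp-ideate`, planner memo `r24/CORE-BOUND-NOTES.md` §9 R5–R9; restricted-model proof complexity —
nothing here bears on `P` versus `NP`).

An EXC-UNIT of direction `m` is a chord `e` with `D e = {j₁, j₂}` (disjoint AND pairs, `σ ∈ andPair j₁`, `τ ∈ andPair j₂`) and the POLAR FORMULA of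
`PstarNorUnitExcCore.exc_unit_core`: `polarDir I B m (e_v, e_w) = [v,w AND-adjacent in D e] + [{v,w} = {σ,τ}]`.  This file derives what the assembly
of the direction picture needs (all hypotheses stated explicitly, no new definitions):

* `mem_or_pair_of_polar_one` — an output `k` whose AND pair has `polarDir`-value `1` lies in `D e` or has AND pair `{σ,τ}`;
* `not_EQ_of_excUnit` — an EXC-unit is not (EQ) w.r.t. any quadratic with polar form `polarDir I B m`;
* `false_of_nor_of_excUnit` — no chord is (NOR) in direction `m` (the realiser graph `b—σ—τ—b'` is a path, not complete multipartite);
* `D_eq_of_excUnits` — two EXC-units of direction `m` have the same fundamental set (so coincide, `eq_of_fundamental_eq`);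
* `D_subset_of_EQ_of_excUnit` / `card_D_le_three_of_EQ_of_excUnit` — an (EQ) chord `e'` next to an EXC-unit `e` has `D e ⊆ D e'` and `#D e' ≤ 3`,
  so the unit family of `{e, e'}` has at most five outputs (`card_units_le_five_of_EQ_of_excUnit`).
-/

set_option linter.dupNamespace false -- `Summit.PneNP.PneNP.…`: summit = sub-problem name (D-0017 single-conjunct layout)

open Finset Module Literature.Computability.Complexity
open Summit.PneNP.PneNP.Theorems.PstarSALevel (varSet bdry BoundaryExpanding SimpleOverlap)
open Summit.PneNP.PneNP.Theorems.PstarGapLinearised (andPair)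
open Summit.PneNP.PneNP.Theorems.PstarChordEndgameTools (mem_andPair_iff)
open Summit.PneNP.PneNP.Theorems.PstarCubeIdeals (IsAffineFn)
open Summit.PneNP.PneNP.Theorems.PstarRankRigidityTwo (linPart symForm symForm_apply linPart_apply affine_mul_polar)
open Summit.PneNP.PneNP.Theorems.PstarForcing (polar_unique)
open Summit.PneNP.PneNP.Theorems.PstarProductRank (qform polar)
open Summit.PneNP.PneNP.Theorems.PstarPathRank (AndAdj polar_basis)
open Summit.PneNP.PneNP.Theorems.PstarChordBridge (BridgeData)
open Summit.PneNP.PneNP.Theorems.PstarReadSumset (V2)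
open Summit.PneNP.PneNP.Theorems.PstarChordBridgeForcing (qform_add')
open Summit.PneNP.PneNP.Theorems.PstarChordBridgeBasis (qDir polarDir)
open Summit.PneNP.PneNP.Theorems.PstarChordBridgeCorner (andAdj_iff_mem qDir_add)
open Summit.PneNP.PneNP.Theorems.PstarNorUnitCases (mem_of_andAdj andPair_eq_of_mem)
open Summit.PneNP.PneNP.Theorems.PstarNorUnitGraph (eq_of_two_shared)

namespace Summit.PneNP.PneNP.Theorems.PstarNorUnitMixed

variable {n m : ℕ}

/-! ## Reading the polar formula -/

/-- **An output whose AND pair is `polarDir`-active lies in the unit or is a `{σ,τ}`-gadget.** -/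
theorem mem_or_pair_of_polar_one (I : LocalMap 4 n m) (hI : I.IsPure xorAndPred) (hS : SimpleOverlap I) {B : BridgeData n m} {mv : V2}
    {D : Finset (Fin m)} {σ τ : Fin n}
    (hform : ∀ v w : Fin n, polarDir I B mv (Pi.single v 1) (Pi.single w 1) =
      (if AndAdj I D v w then 1 else 0) + (if (v = σ ∧ w = τ) ∨ (v = τ ∧ w = σ) then 1 else 0))
    {k : Fin m} (hk : polarDir I B mv (Pi.single (I.vars k 2) 1) (Pi.single (I.vars k 3) 1) = 1) :
    k ∈ D ∨ (σ ∈ andPair I k ∧ τ ∈ andPair I k) := by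
  rw [hform] at hk
  by_cases hA : AndAdj I D (I.vars k 2) (I.vars k 3)
  · exact Or.inl ((andAdj_iff_mem I hI hS D k).1 hA)
  · rw [if_neg hA, zero_add] at hk
    by_cases hp : (I.vars k 2 = σ ∧ I.vars k 3 = τ) ∨ (I.vars k 2 = τ ∧ I.vars k 3 = σ)
    · right
      rw [mem_andPair_iff, mem_andPair_iff]
      rcases hp with ⟨h2, h3⟩ | ⟨h2, h3⟩
      · exact ⟨Or.inl h2.symm, Or.inr h3.symm⟩
      · exact ⟨Or.inr h3.symm, Or.inl h2.symm⟩
    · rw [if_neg hp] at hk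
      exact absurd hk zero_ne_one

/-- **The unit's own outputs are `polarDir`-active.** -/
theorem polar_one_of_mem_unit (I : LocalMap 4 n m) (hI : I.IsPure xorAndPred) (hS : SimpleOverlap I) {B : BridgeData n m} {mv : V2}
    {D : Finset (Fin m)} {j₁ j₂ : Fin m} {σ τ : Fin n} (hD : D = {j₁, j₂}) (hdisj : Disjoint (andPair I j₁) (andPair I j₂))
    (hσ : σ ∈ andPair I j₁) (hτ : τ ∈ andPair I j₂)
    (hform : ∀ v w : Fin n, polarDir I B mv (Pi.single v 1) (Pi.single w 1) =
      (if AndAdj I D v w then 1 else 0) + (if (v = σ ∧ w = τ) ∨ (v = τ ∧ w = σ) then 1 else 0))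
    {k : Fin m} (hk : k ∈ D) : polarDir I B mv (Pi.single (I.vars k 2) 1) (Pi.single (I.vars k 3) 1) = 1 := by
  rw [hform, if_pos ((andAdj_iff_mem I hI hS D k).2 hk), if_neg, add_zero]
  -- the AND pair of `k ∈ {j₁, j₂}` is not `{σ, τ}`
  have h2 : I.vars k 2 ∈ andPair I k := (mem_andPair_iff I k _).2 (Or.inl rfl)
  have h3 : I.vars k 3 ∈ andPair I k := (mem_andPair_iff I k _).2 (Or.inr rfl)
  rw [hD, mem_insert, mem_singleton] at hk
  rintro (⟨hσ', hτ'⟩ | ⟨hτ', hσ'⟩)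
  · rcases hk with rfl | rfl
    · exact Finset.disjoint_left.1 hdisj (hτ' ▸ h3) hτ
    · exact Finset.disjoint_left.1 hdisj hσ (hσ' ▸ h2)
  · rcases hk with rfl | rfl
    · exact Finset.disjoint_left.1 hdisj (hτ' ▸ h2) hτ
    · exact Finset.disjoint_left.1 hdisj hσ (hσ' ▸ h3)

/-- The unit's literals are distinct. -/
theorem ne_of_unit (I : LocalMap 4 n m) {j₁ j₂ : Fin m} {σ τ : Fin n} (hdisj : Disjoint (andPair I j₁) (andPair I j₂))
    (hσ : σ ∈ andPair I j₁) (hτ : τ ∈ andPair I j₂) : σ ≠ τ := fun h => Finset.disjoint_left.1 hdisj hσ (h ▸ hτ)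

/-- `polarDir(e_σ, e_τ) = 1` for a unit. -/
theorem polar_gadget_of_unit (I : LocalMap 4 n m) {B : BridgeData n m} {mv : V2} {D : Finset (Fin m)} {j₁ j₂ : Fin m} {σ τ : Fin n}
    (hD : D = {j₁, j₂}) (hdisj : Disjoint (andPair I j₁) (andPair I j₂)) (hσ : σ ∈ andPair I j₁) (hτ : τ ∈ andPair I j₂)
    (hform : ∀ v w : Fin n, polarDir I B mv (Pi.single v 1) (Pi.single w 1) =
      (if AndAdj I D v w then 1 else 0) + (if (v = σ ∧ w = τ) ∨ (v = τ ∧ w = σ) then 1 else 0)) :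
    polarDir I B mv (Pi.single σ 1) (Pi.single τ 1) = 1 := by
  rw [hform, if_neg, if_pos (Or.inl ⟨rfl, rfl⟩), zero_add]
  intro hA
  obtain ⟨j, hj, hσj, hτj⟩ := mem_of_andAdj hA
  rw [hD, mem_insert, mem_singleton] at hj
  rcases hj with rfl | rfl
  · exact Finset.disjoint_left.1 hdisj hτj hτ
  · exact Finset.disjoint_left.1 hdisj hσ hσj

/-! ## An EXC-unit is not (EQ) -/

/-- **An EXC-unit is not (EQ)**: `Q_{D e} = q + κ'` for a `q` with polar form `polarDir` would make `polar(Q_{D e}) = polarDir`, but the gadget pair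
`{σ,τ}` is `polarDir`-active and not an AND pair of `D e`. -/
theorem not_EQ_of_excUnit (I : LocalMap 4 n m) (hI : I.IsPure xorAndPred) (hS : SimpleOverlap I) {B : BridgeData n m} {mv : V2}
    {D : Finset (Fin m)} {j₁ j₂ : Fin m} {σ τ : Fin n} (hD : D = {j₁, j₂}) (hdisj : Disjoint (andPair I j₁) (andPair I j₂))
    (hσ : σ ∈ andPair I j₁) (hτ : τ ∈ andPair I j₂)
    (hform : ∀ v w : Fin n, polarDir I B mv (Pi.single v 1) (Pi.single w 1) =
      (if AndAdj I D v w then 1 else 0) + (if (v = σ ∧ w = τ) ∨ (v = τ ∧ w = σ) then 1 else 0))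
    {q : (Fin n → ZMod 2) → ZMod 2} (hqB : ∀ x w, q (x + w) = q x + q w + q 0 + polarDir I B mv x w) {κ' : ZMod 2}
    (hEQ : ∀ x, qform D (fun j => I.vars j 2) (fun j => I.vars j 3) x = q x + κ') : False := by
  have hpol : polar D (fun j => I.vars j 2) (fun j => I.vars j 3) = polarDir I B mv := by
    refine polar_unique (qform_add' I D) fun x w => ?_
    rw [hEQ (x + w), hEQ x, hEQ w, hEQ 0, hqB]
    generalize q x = s; generalize q w = s'; generalize q 0 = s₀; generalize polarDir I B mv x w = t; generalize κ' = c
    revert s s' s₀ t c; decide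
  have h := LinearMap.congr_fun (LinearMap.congr_fun hpol (Pi.single σ 1)) (Pi.single τ 1)
  rw [polar_basis I hI hS, polar_gadget_of_unit I hD hdisj hσ hτ hform, if_neg] at h
  · exact zero_ne_one h
  · intro hA
    obtain ⟨j, hj, hσj, hτj⟩ := mem_of_andAdj hA
    rw [hD, mem_insert, mem_singleton] at hj
    rcases hj with rfl | rfl
    · exact Finset.disjoint_left.1 hdisj hτj hτ
    · exact Finset.disjoint_left.1 hdisj hσ hσj

/-! ## No (NOR) chord next to an EXC-unit -/

/-- The determinant labelling of a path `b₁ — σ — τ — b₂` is impossible. -/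
theorem false_of_path_labels {L L' : Fin n → ZMod 2} {σ τ b₁ b₂ : Fin n}
    (h1 : L σ * L' b₁ + L b₁ * L' σ = 1) (h2 : L τ * L' b₂ + L b₂ * L' τ = 1) (h3 : L σ * L' τ + L τ * L' σ = 1)
    (h4 : L b₁ * L' b₂ + L b₂ * L' b₁ = 0) (h5 : L σ * L' b₂ + L b₂ * L' σ = 0) (h6 : L τ * L' b₁ + L b₁ * L' τ = 0) : False := by
  revert h1 h2 h3 h4 h5 h6
  generalize L σ = a; generalize L' σ = a'; generalize L τ = c; generalize L' τ = c'
  generalize L b₁ = d; generalize L' b₁ = d'; generalize L b₂ = f; generalize L' b₂ = f'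
  revert a a' c c' d d' f f'; decide

/-- **No chord is (NOR) in the direction of an EXC-unit**: a NOR form `q_m = λ_b·λ_a + ζ` makes `polarDir = ℓ_b ∧ ℓ_a` a determinant labelling,
under which the active pairs form a complete multipartite graph — but the unit's active pairs form the path `b₁ — σ — τ — b₂`. -/
theorem false_of_nor_of_excUnit (I : LocalMap 4 n m) (hI : I.IsPure xorAndPred) {B : BridgeData n m} {mv : V2}
    {D : Finset (Fin m)} {j₁ j₂ : Fin m} {σ τ : Fin n} (hD : D = {j₁, j₂}) (hdisj : Disjoint (andPair I j₁) (andPair I j₂))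
    (hσ : σ ∈ andPair I j₁) (hτ : τ ∈ andPair I j₂)
    (hform : ∀ v w : Fin n, polarDir I B mv (Pi.single v 1) (Pi.single w 1) =
      (if AndAdj I D v w then 1 else 0) + (if (v = σ ∧ w = τ) ∨ (v = τ ∧ w = σ) then 1 else 0))
    {a b : Fin n → ZMod 2} {β α ζ : ZMod 2} (hq : ∀ x, qDir I B mv x = (polarDir I B mv x b + β) * (polarDir I B mv x a + α) + ζ) : False := by
  classical
  set fP := polarDir I B mv with hfP
  -- the two AND partners
  have h23 : ∀ j : Fin m, I.vars j 2 ≠ I.vars j 3 := fun j h => absurd (hI.2 j h) (by decide)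
  obtain ⟨b₁, hb₁, hb₁σ⟩ : ∃ b₁ ∈ andPair I j₁, b₁ ≠ σ := by
    rcases (mem_andPair_iff I j₁ σ).1 hσ with h | h
    · exact ⟨I.vars j₁ 3, (mem_andPair_iff I j₁ _).2 (Or.inr rfl), fun e => h23 j₁ (h.symm.trans e.symm)⟩
    · exact ⟨I.vars j₁ 2, (mem_andPair_iff I j₁ _).2 (Or.inl rfl), fun e => h23 j₁ (e.trans h)⟩
  obtain ⟨b₂, hb₂, hb₂τ⟩ : ∃ b₂ ∈ andPair I j₂, b₂ ≠ τ := by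
    rcases (mem_andPair_iff I j₂ τ).1 hτ with h | h
    · exact ⟨I.vars j₂ 3, (mem_andPair_iff I j₂ _).2 (Or.inr rfl), fun e => h23 j₂ (h.symm.trans e.symm)⟩
    · exact ⟨I.vars j₂ 2, (mem_andPair_iff I j₂ _).2 (Or.inl rfl), fun e => h23 j₂ (e.trans h)⟩
  have hστ : σ ≠ τ := ne_of_unit I hdisj hσ hτ
  have hb₁τ : b₁ ≠ τ := fun h => Finset.disjoint_left.1 hdisj hb₁ (h ▸ hτ)
  have hb₂σ : b₂ ≠ σ := fun h => Finset.disjoint_left.1 hdisj hσ (h ▸ hb₂)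
  have hb₁b₂ : b₁ ≠ b₂ := fun h => Finset.disjoint_left.1 hdisj hb₁ (h ▸ hb₂)
  have hj₁ : j₁ ∈ D := by rw [hD]; exact mem_insert_self _ _
  have hj₂ : j₂ ∈ D := by rw [hD]; exact mem_insert_of_mem (mem_singleton_self _)
  -- which pairs are AND-adjacent in `D`
  have adjD : ∀ v w, AndAdj I D v w → (v ∈ andPair I j₁ ∧ w ∈ andPair I j₁) ∨ (v ∈ andPair I j₂ ∧ w ∈ andPair I j₂) := by
    intro v w h
    obtain ⟨j, hj, hv, hw⟩ := mem_of_andAdj h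
    rw [hD, mem_insert, mem_singleton] at hj
    rcases hj with rfl | rfl
    · exact Or.inl ⟨hv, hw⟩
    · exact Or.inr ⟨hv, hw⟩
  have n1 : ∀ {v}, v ∈ andPair I j₂ → v ∉ andPair I j₁ := fun hv h => Finset.disjoint_left.1 hdisj h hv
  have n2 : ∀ {v}, v ∈ andPair I j₁ → v ∉ andPair I j₂ := fun hv h => Finset.disjoint_left.1 hdisj hv h
  -- the six values of `polarDir`
  have v1 : fP (Pi.single σ 1) (Pi.single b₁ 1) = 1 := by
    rw [hfP, hform, if_pos (PstarNorUnitCases.andAdj_of_mem hj₁ hb₁σ.symm hσ hb₁), if_neg, add_zero]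
    rintro (⟨-, h⟩ | ⟨h, -⟩)
    · exact hb₁τ h
    · exact hστ h
  have v2 : fP (Pi.single τ 1) (Pi.single b₂ 1) = 1 := by
    rw [hfP, hform, if_pos (PstarNorUnitCases.andAdj_of_mem hj₂ hb₂τ.symm hτ hb₂), if_neg, add_zero]
    rintro (⟨h, -⟩ | ⟨-, h⟩)
    · exact hστ h.symm
    · exact hb₂σ h
  have v3 : fP (Pi.single σ 1) (Pi.single τ 1) = 1 := polar_gadget_of_unit I hD hdisj hσ hτ hform
  have v4 : fP (Pi.single b₁ 1) (Pi.single b₂ 1) = 0 := by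
    rw [hfP, hform, if_neg, if_neg, add_zero]
    · rintro (⟨h, -⟩ | ⟨-, h⟩)
      · exact hb₁σ h
      · exact hb₂σ h
    · intro h
      rcases adjD _ _ h with ⟨-, h⟩ | ⟨h, -⟩
      · exact n1 hb₂ h
      · exact n2 hb₁ h
  have v5 : fP (Pi.single σ 1) (Pi.single b₂ 1) = 0 := by
    rw [hfP, hform, if_neg, if_neg, add_zero]
    · rintro (⟨-, h⟩ | ⟨h, -⟩)
      · exact hb₂τ h
      · exact hστ h
    · intro h
      rcases adjD _ _ h with ⟨-, h⟩ | ⟨h, -⟩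
      · exact n1 hb₂ h
      · exact n2 hσ h
  have v6 : fP (Pi.single τ 1) (Pi.single b₁ 1) = 0 := by
    rw [hfP, hform, if_neg, if_neg, add_zero]
    · rintro (⟨h, -⟩ | ⟨-, h⟩)
      · exact hστ h.symm
      · exact hb₁σ h
    · intro h
      rcases adjD _ _ h with ⟨h, -⟩ | ⟨-, h⟩
      · exact n1 hτ h
      · exact n2 hb₁ h
  -- `polarDir` is the determinant labelling of the NOR factors
  have haff : ∀ (y : Fin n → ZMod 2) (k : ZMod 2), IsAffineFn (fun x => fP x y + k) := by
    intro y k x w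
    show fP (x + w) y + k = fP x y + k + (fP w y + k) + (fP 0 y + k)
    rw [map_add, LinearMap.add_apply, map_zero, LinearMap.zero_apply, zero_add]
    generalize fP x y = s; generalize fP w y = t
    revert s t k; decide
  have hlb : IsAffineFn (fun x => fP x b + β) := haff b β
  have hla : IsAffineFn (fun x => fP x a + α) := haff a α
  have hpol : fP = symForm (linPart hlb) (linPart hla) := by
    refine polar_unique (Q := qDir I B mv) (qDir_add I B mv) fun x w => ?_
    rw [hq, hq x, hq w, hq 0, affine_mul_polar hlb hla]
    generalize (fP x b + β) * (fP x a + α) = s; generalize (fP w b + β) * (fP w a + α) = s'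
    generalize (fP 0 b + β) * (fP 0 a + α) = s₀; generalize symForm (linPart hlb) (linPart hla) x w = t
    generalize ζ = k
    revert s s' s₀ t k; decide
  rw [hpol, symForm_apply] at v1 v2 v3 v4 v5 v6
  exact false_of_path_labels (L := fun v => linPart hlb (Pi.single v 1)) (L' := fun v => linPart hla (Pi.single v 1)) v1 v2 v3 v4 v5 v6

/-! ## Uniqueness of the EXC-unit -/

/-- **Two EXC-units of one direction have the same fundamental set** (hence coincide, `PstarChordBridgeFundamental.eq_of_fundamental_eq`). -/
theorem D_eq_of_excUnits (I : LocalMap 4 n m) (hI : I.IsPure xorAndPred) (hS : SimpleOverlap I) {B : BridgeData n m} {mv : V2}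
    {D : Finset (Fin m)} {j₁ j₂ : Fin m} {σ τ : Fin n} (hD : D = {j₁, j₂}) (hdisj : Disjoint (andPair I j₁) (andPair I j₂))
    (hσ : σ ∈ andPair I j₁) (hτ : τ ∈ andPair I j₂)
    (hform : ∀ v w : Fin n, polarDir I B mv (Pi.single v 1) (Pi.single w 1) =
      (if AndAdj I D v w then 1 else 0) + (if (v = σ ∧ w = τ) ∨ (v = τ ∧ w = σ) then 1 else 0))
    {D' : Finset (Fin m)} {k₁ k₂ : Fin m} {σ' τ' : Fin n} (hne' : k₁ ≠ k₂) (hD' : D' = {k₁, k₂})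
    (hdisj' : Disjoint (andPair I k₁) (andPair I k₂)) (hσ' : σ' ∈ andPair I k₁) (hτ' : τ' ∈ andPair I k₂)
    (hform' : ∀ v w : Fin n, polarDir I B mv (Pi.single v 1) (Pi.single w 1) =
      (if AndAdj I D' v w then 1 else 0) + (if (v = σ' ∧ w = τ') ∨ (v = τ' ∧ w = σ') then 1 else 0)) :
    D' = D := by
  classical
  have hστ : σ ≠ τ := ne_of_unit I hdisj hσ hτ
  -- each output of `D'` lies in `D` or is a `{σ,τ}`-gadget
  have hk : ∀ k ∈ D', k ∈ D ∨ (σ ∈ andPair I k ∧ τ ∈ andPair I k) := fun k hk =>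
    mem_or_pair_of_polar_one I hI hS hform (polar_one_of_mem_unit I hI hS hD' hdisj' hσ' hτ' hform' hk)
  have hk₁ : k₁ ∈ D' := by rw [hD']; exact mem_insert_self _ _
  have hk₂ : k₂ ∈ D' := by rw [hD']; exact mem_insert_of_mem (mem_singleton_self _)
  -- a `{σ,τ}`-gadget in `D'` would meet the AND pair of the other output of `D'`, which lies in `D`
  have meet : ∀ {k k' : Fin m}, Disjoint (andPair I k) (andPair I k') → σ ∈ andPair I k → τ ∈ andPair I k → k' ∈ D → False := by
    intro k k' hd hσk hτk hk'
    rw [hD, mem_insert, mem_singleton] at hk'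
    rcases hk' with rfl | rfl
    · exact Finset.disjoint_left.1 hd hσk hσ
    · exact Finset.disjoint_left.1 hd hτk hτ
  have hk₁D : k₁ ∈ D := by
    rcases hk k₁ hk₁ with h | ⟨hσk, hτk⟩
    · exact h
    · rcases hk k₂ hk₂ with h' | ⟨hσk', -⟩
      · exact absurd (meet hdisj' hσk hτk h') id
      · exact absurd (Finset.disjoint_left.1 hdisj' hσk hσk') id
  have hk₂D : k₂ ∈ D := by
    rcases hk k₂ hk₂ with h | ⟨hσk, hτk⟩
    · exact h
    · exact absurd (meet hdisj'.symm hσk hτk hk₁D) id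
  -- `D' ⊆ D`, both of size two
  have hsub : D' ⊆ D := by
    intro k hkD
    rw [hD', mem_insert, mem_singleton] at hkD
    rcases hkD with rfl | rfl
    · exact hk₁D
    · exact hk₂D
  refine eq_of_subset_of_card_le hsub ?_
  rw [hD', hD, card_pair hne']
  exact card_insert_le _ _

/-! ## The (EQ) companion of an EXC-unit -/

/-- **An (EQ) chord next to an EXC-unit**: its fundamental set contains the unit's and otherwise only `{σ,τ}`-gadgets; so it has at most three
outputs. -/
theorem D_subset_of_EQ_of_excUnit (I : LocalMap 4 n m) (hI : I.IsPure xorAndPred) (hS : SimpleOverlap I) {B : BridgeData n m} {mv : V2}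
    {D : Finset (Fin m)} {j₁ j₂ : Fin m} {σ τ : Fin n} (hD : D = {j₁, j₂}) (hdisj : Disjoint (andPair I j₁) (andPair I j₂))
    (hσ : σ ∈ andPair I j₁) (hτ : τ ∈ andPair I j₂)
    (hform : ∀ v w : Fin n, polarDir I B mv (Pi.single v 1) (Pi.single w 1) =
      (if AndAdj I D v w then 1 else 0) + (if (v = σ ∧ w = τ) ∨ (v = τ ∧ w = σ) then 1 else 0))
    {q : (Fin n → ZMod 2) → ZMod 2} (hqB : ∀ x w, q (x + w) = q x + q w + q 0 + polarDir I B mv x w) {D' : Finset (Fin m)} {κ' : ZMod 2}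
    (hEQ : ∀ x, qform D' (fun j => I.vars j 2) (fun j => I.vars j 3) x = q x + κ') :
    D ⊆ D' ∧ (∀ k ∈ D', k ∈ D ∨ (σ ∈ andPair I k ∧ τ ∈ andPair I k)) ∧ D'.card ≤ 3 := by
  classical
  have hστ : σ ≠ τ := ne_of_unit I hdisj hσ hτ
  have hpol : polar D' (fun j => I.vars j 2) (fun j => I.vars j 3) = polarDir I B mv := by
    refine polar_unique (qform_add' I D') fun x w => ?_
    rw [hEQ (x + w), hEQ x, hEQ w, hEQ 0, hqB]
    generalize q x = s; generalize q w = s'; generalize q 0 = s₀; generalize polarDir I B mv x w = t; generalize κ' = c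
    revert s s' s₀ t c; decide
  have hval : ∀ k : Fin m, polarDir I B mv (Pi.single (I.vars k 2) 1) (Pi.single (I.vars k 3) 1) = if k ∈ D' then 1 else 0 := by
    intro k
    have h := LinearMap.congr_fun (LinearMap.congr_fun hpol (Pi.single (I.vars k 2) 1)) (Pi.single (I.vars k 3) 1)
    rw [polar_basis I hI hS] at h
    rw [← h]
    by_cases hk : k ∈ D'
    · rw [if_pos ((andAdj_iff_mem I hI hS D' k).2 hk), if_pos hk]
    · rw [if_neg (fun h' => hk ((andAdj_iff_mem I hI hS D' k).1 h')), if_neg hk]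
  have hsub : D ⊆ D' := by
    intro k hk
    have h1 := polar_one_of_mem_unit I hI hS hD hdisj hσ hτ hform hk
    rw [hval k] at h1
    by_contra hkD
    rw [if_neg hkD] at h1
    exact zero_ne_one h1
  have hmem : ∀ k ∈ D', k ∈ D ∨ (σ ∈ andPair I k ∧ τ ∈ andPair I k) := fun k hk =>
    mem_or_pair_of_polar_one I hI hS hform (by rw [hval k, if_pos hk])
  refine ⟨hsub, hmem, ?_⟩
  -- `D' ⊆ D ∪ {gadgets}`, and two gadgets coincide
  have hgad : ((D'.filter fun k => k ∉ D)).card ≤ 1 := by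
    refine card_le_one.2 fun k hk k' hk' => ?_
    obtain ⟨hkD', hkD⟩ := mem_filter.1 hk
    obtain ⟨hk'D', hk'D⟩ := mem_filter.1 hk'
    obtain ⟨hσk, hτk⟩ := (hmem k hkD').resolve_left hkD
    obtain ⟨hσk', hτk'⟩ := (hmem k' hk'D').resolve_left hk'D
    by_contra hne
    exact eq_of_two_shared hS hne hστ hσk hσk' hτk hτk'
  have hsplit := card_filter_add_card_filter_not (s := D') (fun k => k ∈ D)
  have hin : (D'.filter fun k => k ∈ D).card ≤ 2 := by
    refine (card_le_card (fun k hk => (mem_filter.1 hk).2)).trans ?_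
    rw [hD]
    exact card_insert_le _ _
  omega

/-- **The unit family of an EXC-unit and its (EQ) companion has at most five outputs.** -/
theorem card_units_le_five_of_EQ_of_excUnit (I : LocalMap 4 n m) (hI : I.IsPure xorAndPred) (hS : SimpleOverlap I) {B : BridgeData n m}
    {mv : V2} {e e' j₁ j₂ : Fin m} {σ τ : Fin n} (hD : B.D e = {j₁, j₂}) (hdisj : Disjoint (andPair I j₁) (andPair I j₂))
    (hσ : σ ∈ andPair I j₁) (hτ : τ ∈ andPair I j₂)
    (hform : ∀ v w : Fin n, polarDir I B mv (Pi.single v 1) (Pi.single w 1) =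
      (if AndAdj I (B.D e) v w then 1 else 0) + (if (v = σ ∧ w = τ) ∨ (v = τ ∧ w = σ) then 1 else 0))
    {q : (Fin n → ZMod 2) → ZMod 2} (hqB : ∀ x w, q (x + w) = q x + q w + q 0 + polarDir I B mv x w) {κ' : ZMod 2}
    (hEQ : ∀ x, qform (B.D e') (fun j => I.vars j 2) (fun j => I.vars j 3) x = q x + κ') (hN : B.N = {e, e'}) :
    (B.N ∪ B.N.biUnion B.D).card ≤ 5 := by
  classical
  obtain ⟨hsub, -, h3⟩ := D_subset_of_EQ_of_excUnit I hI hS hD hdisj hσ hτ hform hqB hEQ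
  have hU : B.N ∪ B.N.biUnion B.D ⊆ {e, e'} ∪ B.D e' := by
    intro k hk
    rcases mem_union.1 hk with h | h
    · exact mem_union_left _ (hN ▸ h)
    · obtain ⟨f, hf, hkf⟩ := mem_biUnion.1 h
      rw [hN, mem_insert, mem_singleton] at hf
      rcases hf with rfl | rfl
      · exact mem_union_right _ (hsub hkf)
      · exact mem_union_right _ hkf
  refine (card_le_card hU).trans ((card_union_le _ _).trans ?_)
  have := card_insert_le e ({e'} : Finset (Fin m))
  rw [card_singleton] at this
  omega

end Summit.PneNP.PneNP.Theorems.PstarNorUnitMixed
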